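import Literature.Analysis.FluidPDE.NSCriticalClosureOfHigherRegularity
import Literature.Analysis.FluidPDE.NSBoundedHigherRegularityQuantProofs
import HarnessLib

/-!
# Discharge of the `L³` continuation criterion (Seregin 2012, Thm. 1.1; ESS 2003, Thms. 1.3–1.4)

Analysis/FluidPDE proofs-only file: the discharge
`hasSmoothExtensionPast_of_eLpNorm_three_bounded_holds` of the named fact
`Literature.Analysis.FluidPDE.hasSmoothExtensionPast_of_eLpNorm_three_bounded`
(`NSCriticalClosure.lean`), as the composition of the accepted reduction
`hasSmoothExtensionPast_of_eLpNorm_three_bounded_of_higherRegularityBounds`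
(`NSCriticalClosureOfHigherRegularity.lean`: ESS (3.6) ⇐ ESS Thm. 1.4 ⇐ Serrin's quantitative
interior regularity, everything else proved in the tree) with the discharge
`NSBoundedHigherRegularityBounds_holds`.

## References

* G. Seregin, Comm. Math. Phys. 312 (2012) 833–845 = arXiv:1104.3615, Thm. 1.1. [`Seregin2012CMP`]
* L. Escauriaza, G. Seregin, V. Šverák, Russ. Math. Surveys 58:2 (2003) 211–250, Thms. 1.3–1.4,
  §3 (3.5)–(3.6). [`EscauriazaSereginSverak2003`]
-/

noncomputable section

namespace Literature.Analysis.FluidPDE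

/-- **Seregin 2012, Thm. 1.1 (in the `limsup` form of ESS 2003, Thm. 1.3): a classical
Leray–Hopf solution from a rapidly decaying datum whose `L³` norm stays bounded on `[0, T)`
extends to a classical solution past `T`.** Discharge of the named fact
`hasSmoothExtensionPast_of_eLpNorm_three_bounded`. [cite: Seregin2012CMP, Thm. 1.1 (with EscauriazaSereginSverak2003 Thms. 1.3–1.4, §3 (3.5)–(3.6))] -/
theorem hasSmoothExtensionPast_of_eLpNorm_three_bounded_holds :
    hasSmoothExtensionPast_of_eLpNorm_three_bounded :=
  hasSmoothExtensionPast_of_eLpNorm_three_bounded_of_higherRegularityBounds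
    NSBoundedHigherRegularityBounds_holds

end Literature.Analysis.FluidPDE
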